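import Summits.Langlands.Langlands.Cruxes.ResiduallyYoshidaLifting.CrossRegularCurrency

/-!
# `stub_exactCrossElement` (S1 of line `cross-regular-annihilator-primes`, crux stmt-Langlands-13639)
# is FALSE on the `p = 3` Frobenius-twist sub-sector — from the crux disprover (cdisprove gen 3)

`Summit.…CrossRegular.ExactCross σ σ' red ρ` (the CONCLUSION of S1) is unsatisfiable for every `ρ` and
every `red` when `k` has characteristic `3` and `charpoly σ̄'(γ) = Frob(charpoly σ̄(γ))` for all `γ`
(the phantom-RM pairs `σ̄' = σ̄^(3)`, the route's own source of `ρ`).  Hence S1 holds at such an input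
iff its hypotheses are vacuous there; in nature they are not (abelian surfaces with `Sp₂(9)`-type
3-torsion), in the tree no such pair is constructible, so no formal `¬ S1` can be filed.
Corrected signature (stub-misstated): add `5 ≤ p` and exclude Frobenius-twisted pairs without a
cross-regular class — or, as the planner asks, move `ExactCross σ σ' red ρ` into the crux as a hypothesis.
Sorry-free; axioms standard; elaborates against the published currency module.
-/

open Literature.NumberTheory.GaloisRepresentations
open Summit.Langlands.Langlands.Cruxes.ResiduallyYoshidaLifting.CrossRegular

namespace Summit.Langlands.Langlands.Cruxes.ResiduallyYoshidaLifting.NegExactCrossFrobTwistThree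

set_option linter.dupNamespace false

/-- Algebraic core: characteristic 3, `e³ = e`, `e²ab = 1`, `Gen e a b`,
`(X − ea)(X − b) = Frob((X − a)(X − eb))` is contradictory. -/
theorem no_exactCross_frobTwist_char3 {k : Type} [Field k] [CharP k 3] {e a b : k}
    (he : e ^ 3 = e) (hab : e ^ 2 * a * b = 1) (hgen : Gen e a b)
    (hcross : (Polynomial.X - Polynomial.C (e * a)) * (Polynomial.X - Polynomial.C b) =
      ((Polynomial.X - Polynomial.C a) * (Polynomial.X - Polynomial.C (e * b))).map (frobenius k 3)) :
    False := by
  obtain ⟨h1, h2, h3, h4, -, -, -, -⟩ := hgen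
  have ha : a ≠ 0 := by
    rintro rfl
    exact h1 (by ring)
  have he0 : e ≠ 0 := by
    rintro rfl
    simp at hab
  have he1 : e ≠ 1 := by
    rintro rfl
    exact h1 (by ring)
  -- `e³ = e`, `e ≠ 0, 1` ⇒ `e = -1`
  have he' : e = -1 := by
    have h0 : e * (e - 1) * (e + 1) = 0 := by linear_combination he
    rcases mul_eq_zero.mp h0 with h | h
    · rcases mul_eq_zero.mp h with h | h
      · exact absurd h he0
      · exact absurd (sub_eq_zero.mp h) he1
    · linear_combination h
  subst he'
  have hab' : a * b = 1 := by linear_combination hab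
  have hb : b ≠ 0 := by
    rintro rfl
    simp at hab'
  -- the Frobenius-twisted quadratic, explicitly
  simp only [Polynomial.map_mul, Polynomial.map_sub, Polynomial.map_X, Polynomial.map_C,
    frobenius_def] at hcross
  have hev1 := congrArg (Polynomial.eval (-1 * a)) hcross
  have hev2 := congrArg (Polynomial.eval b) hcross
  simp only [Polynomial.eval_mul, Polynomial.eval_sub, Polynomial.eval_X, Polynomial.eval_C,
    sub_self, zero_mul, mul_zero] at hev1 hev2
  have hA : a ^ 3 = -a ∨ a = b ^ 3 := by
    rcases mul_eq_zero.mp hev1.symm with h | h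
    · left; linear_combination -h
    · right; linear_combination -h
  have hB : b = a ^ 3 ∨ b ^ 3 = -b := by
    rcases mul_eq_zero.mp hev2.symm with h | h
    · left; linear_combination h
    · right; linear_combination h
  rcases hA with hA | hA <;> rcases hB with hB | hB
  · -- `a³ = -a`, `b = a³` ⇒ `b = -a`
    exact h4 (by linear_combination -hA - hB)
  · -- `a³ = -a` (so `a² = -1`), `b³ = -b`; with `ab = 1`: `b = -a`
    have ha2 : a ^ 2 = -1 := by
      apply mul_left_cancel₀ ha
      linear_combination hA
    exact h4 (by
      apply mul_left_cancel₀ ha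
      linear_combination -hab' - ha2)
  · -- `a = b³`, `b = a³` ⇒ `b⁴ = ab = 1` ⇒ `b² = ±1` ⇒ `a = b` or `a = -b`
    have hb4 : b ^ 4 = 1 := by linear_combination -b * hA + hab'
    have hsq : (b ^ 2 - 1) * (b ^ 2 + 1) = 0 := by linear_combination hb4
    rcases mul_eq_zero.mp hsq with h | h
    · exact h2 (by linear_combination hA + b * h)
    · exact h3 (by linear_combination hA + b * h)
  · -- `a = b³`, `b³ = -b` ⇒ `a = -b`
    exact h3 (by linear_combination hA + hB)

/-- `ℤ_p → ℤ̄_p = Valued.integer (PadicAlgCl p)` (the inclusion, integral since `‖u‖ ≤ 1`). -/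
noncomputable def ofPadicInt (p : ℕ) [Fact p.Prime] : ℤ_[p] →+* Valued.integer (PadicAlgCl p) :=
  RingHom.codRestrict ((algebraMap ℚ_[p] (PadicAlgCl p)).comp PadicInt.Coe.ringHom)
    (Valued.v (R := PadicAlgCl p)).integer fun u => by
      rw [Valuation.mem_integer_iff, PadicAlgCl.valuation_def, ← NNReal.coe_le_coe, coe_nnnorm]
      change ‖((u : ℚ_[p]) : PadicAlgCl p)‖ ≤ 1
      rw [PadicAlgCl.norm_extends]
      exact PadicInt.norm_le_one u

theorem coe_ofPadicInt (p : ℕ) [Fact p.Prime] (u : ℤ_[p]) :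
    ((ofPadicInt p u : Valued.integer (PadicAlgCl p)) : PadicAlgCl p) =
      algebraMap ℚ_[p] (PadicAlgCl p) (u : ℚ_[p]) := rfl

/-- Any ring map `ℤ_p → k` into characteristic `p` takes Frobenius-fixed values (`u = n + p·w`,
`n = zmodRepr u`): its image is the prime field. -/
theorem frobenius_apply_padicInt {p : ℕ} [Fact p.Prime] {k : Type} [CommRing k] [CharP k p]
    (f : ℤ_[p] →+* k) (u : ℤ_[p]) : f u ^ p = f u := by
  have hmem : u - (u.zmodRepr : ℤ_[p]) ∈ Ideal.span {(p : ℤ_[p])} := by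
    rw [← PadicInt.maximalIdeal_eq_span_p]; exact PadicInt.sub_zmodRepr_mem u
  obtain ⟨w, hw⟩ := Ideal.mem_span_singleton'.mp hmem
  have hu : u = (u.zmodRepr : ℤ_[p]) + w * p := by linear_combination -hw
  have hfu : f u = (u.zmodRepr : k) := by
    have h := congrArg f hu
    rwa [map_add, map_natCast, map_mul, map_natCast, CharP.cast_eq_zero k p, mul_zero, add_zero] at h
  rw [hfu]
  have h := map_natCast (frobenius k p) u.zmodRepr
  rwa [frobenius_def] at h

/-- (T6a, interface form) **`ExactCross` is UNSATISFIABLE on the `p = 3` Frobenius-twist sub-sector.**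
If `charpoly σ̄'(γ) = Frob(charpoly σ̄(γ))` for every `γ` (e.g. `σ̄' = σ̄^(3)`: the phantom-RM pairs of
the route's own source), then `ExactCross σ σ' red ρ` fails for EVERY `ρ` and every `red` in
characteristic `3` — so the registered S1 (`stub_exactCrossElement`, conclusion `ExactCross σ σ' red ρ`)
is false at every such admissible input (none is constructible in the tree, whence no formal `¬ S1`).
`red(ε(γ)) ∈ 𝔽₃` by `frobenius_apply_padicInt`; the rest is `no_exactCross_frobTwist_char3`. -/
theorem not_exactCross_of_frobTwist_three {k : Type} [Field k] [CharP k 3] [TopologicalSpace k]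
    (red : Valued.integer (PadicAlgCl 3) →+* k)
    (σ σ' : FramedGaloisRep ℚ k 2) (ρ : FramedGaloisRep ℚ (PadicAlgCl 3) 4)
    (hFrob : ∀ γ, (σ' γ).val.charpoly = ((σ γ).val.charpoly).map (frobenius k 3)) :
    ¬ ExactCross σ σ' red ρ := by
  rintro ⟨γ, a, b, e, he, hab, -, hσ, hσ', hgen⟩
  have he' : e = ofPadicInt 3 ((GaloisRep.cyclotomicCharacter ℚ 3 γ : ℤ_[3]ˣ) : ℤ_[3]) :=
    Subtype.ext he
  have hred3 : red e ^ 3 = red e := by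
    rw [he']
    exact frobenius_apply_padicInt (red.comp (ofPadicInt 3)) _
  have hab' : red e ^ 2 * red a * red b = 1 := by
    simpa using congrArg red hab
  refine no_exactCross_frobTwist_char3 hred3 hab' hgen ?_
  rw [← hσ', hFrob γ, hσ]

end Summit.Langlands.Langlands.Cruxes.ResiduallyYoshidaLifting.NegExactCrossFrobTwistThree
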